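import Summits.AtomisticToContinuum.Crystallization.Theses.ChessboardParticlePlanes
import Summits.AtomisticToContinuum.Crystallization.Theorems.ChessboardParticlePlanesLjPlaneChessboardVerticalPeriod
import Summits.AtomisticToContinuum.Crystallization.Theorems.ChessboardParticlePlanesLjPlaneChessboardAdjacentHeights
import Summits.AtomisticToContinuum.Crystallization.Theorems.ChessboardParticlePlanesLjPlaneChessboardRestackEnergy
import Summits.AtomisticToContinuum.Crystallization.Theorems.ChessboardParticlePlanesLjPlaneChessboardSumToMin

/-!
# Crux `ChessboardParticlePlanes.LjPlaneChessboard` (stmt-AtomisticToContinuum-6709), line `Sketch` —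
# the REDUCTION of the crux to the per-site chessboard deficit inequality

The statement item asks: every `2/3`-separated periodic configuration `Q` of `ℝ³` confined to
horizontal planes with occupied heights pairwise `≥ 3/4` apart is energetically matched by the
period-2 restack of one of its ADJACENT layer pairs (`e_LJ(B) ≤ e_LJ(Q)`).

This file proves, sorry-free, that the crux follows from ONE analytic inequality stated over tree
vocabulary only — the PER-SITE CHESSBOARD DEFICIT INEQUALITY (registered stub `stub_deficitNonneg` of
the lead skeleton `Cruxes/LjPlaneChessboard/Lines/Sketch.lean`):

  for every such `Q` and next/previous occupied-height functions `τu`, `τd`,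
  `0 ≤ Σ_{x ∈ Q.motif} [ 2 h_{Q.points}(x) − h_{R(x₂, τu x₂)}(x) − h_{R(τd x₂, x₂)}(x) ]`,

where `h_S(p) = Σ'_{y ∈ S, y ≠ p} V_LJ(|p − y|)` is the site sum and `R(t,t')` the period-2 restack of the
layers at heights `t < t'`.  This is the chessboard SUM-FORM `e(Q) ≥ Σ_n w_n e(B_n)`,
`w_n = (N_n + N_{n+1})/2N` (Giuliani–Lebowitz–Lieb 2008, Lemma 1, for reflection-positive interactions)
written per site: `N e(Q) = ½ Σ_F h_Q` and `(N_n + N_{n+1}) e(B_n) = ½ Σ h_{B_n}` over a layer-adapted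
transversal; in-layer and nearest-layer terms cancel, so only cross-layer pairs at vertical offsets
`≥ 3/2` enter.

The reduction is the composition of the landed bookkeeping theorems of this namespace:
`stub_verticalPeriod` (heights of periods form `c₀ℤ`), `stub_adjacentHeights` (next/previous occupied
height), `stub_restackEnergy` (layer-adapted energy formula for any presentation of a restack) and
`stub_sumToMin` (the pigeonhole over one vertical period).  What remains open is the inequality
itself: Lennard-Jones is not reflection positive across planes (anti-RP planar modes
`|q| > q*(3/2) = 12.317`; negative Bernstein mass beyond `λ = 302400^{1/6} = 8.19`), and the
domination of that remainder on `2/3`-separated layers is the content of the crux (exact RP engine: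
`stub_sliceIdentity`; slicing: `stub_yukawaSlicing`, both landed).
-/

noncomputable section

namespace Summit.AtomisticToContinuum.Crystallization.Theorems.ChessboardParticlePlanesLjPlaneChessboard

open Literature.MathematicalPhysics.StatisticalMechanics

/-- **The crux `LjPlaneChessboard` follows from the per-site chessboard deficit inequality**
(registered stub `stub_reduction` of the lead skeleton; pure logic over the landed bookkeeping
theorems `stub_verticalPeriod`, `stub_adjacentHeights`, `stub_restackEnergy`, `stub_sumToMin`).
The hypothesis is, verbatim, the statement of the open stub `stub_deficitNonneg`: for every
`2/3`-separated periodic `Q ⊆ ℝ³` with occupied heights pairwise `≥ 3/4` apart and every choice of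
next/previous occupied-height functions `τu`, `τd`,
`0 ≤ Σ_{x ∈ Q.motif} [2 h_{Q.points}(x) − h_{R(x₂, τu x₂)}(x) − h_{R(τd x₂, x₂)}(x)]`.
[folklore; GiulianiLebowitzLieb2008 Lemma 1 (min ≤ weighted mean form of the chessboard estimate)] -/
theorem stub_reduction :
    (∀ (Q : PeriodicConfiguration 3) (τu τd : ℝ → ℝ),
      (∀ x ∈ Q.points, ∀ y ∈ Q.points, x ≠ y → (2 : ℝ) / 3 ≤ dist x y) →
      (∀ x ∈ Q.points, ∀ y ∈ Q.points, x 2 ≠ y 2 → (3 : ℝ) / 4 ≤ |x 2 - y 2|) →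
      (∀ t : ℝ, (∃ x ∈ Q.points, x 2 = t) →
        (t < τu t ∧ (∃ x ∈ Q.points, x 2 = τu t) ∧ (∀ x ∈ Q.points, x 2 ≤ t ∨ τu t ≤ x 2)) ∧
        (τd t < t ∧ (∃ x ∈ Q.points, x 2 = τd t) ∧ (∀ x ∈ Q.points, x 2 ≤ τd t ∨ t ≤ x 2))) →
      0 ≤ ∑ x ∈ Q.motif,
        (2 * (∑' y : {y : EuclideanSpace ℝ (Fin 3) // y ∈ Q.points ∧ y ≠ x},
                lennardJones (dist x y.1))
          - (∑' y : {y : EuclideanSpace ℝ (Fin 3) //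
                y ∈ {p : EuclideanSpace ℝ (Fin 3) | ∃ k : ℤ, ∃ x' ∈ Q.points,
                  (x' 2 = x 2 ∨ x' 2 = τu (x 2)) ∧
                  p = x' + ((2 * (τu (x 2) - x 2)) * (k : ℝ)) •
                    EuclideanSpace.single (2 : Fin 3) (1 : ℝ)} ∧ y ≠ x},
                lennardJones (dist x y.1))
          - (∑' y : {y : EuclideanSpace ℝ (Fin 3) //
                y ∈ {p : EuclideanSpace ℝ (Fin 3) | ∃ k : ℤ, ∃ x' ∈ Q.points,
                  (x' 2 = τd (x 2) ∨ x' 2 = x 2) ∧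
                  p = x' + ((2 * (x 2 - τd (x 2))) * (k : ℝ)) •
                    EuclideanSpace.single (2 : Fin 3) (1 : ℝ)} ∧ y ≠ x},
                lennardJones (dist x y.1)))) →
    Summit.AtomisticToContinuum.Crystallization.Theses.ChessboardParticlePlanes.LjPlaneChessboard := by
  intro hD Q hsep hh
  obtain ⟨c₀, hc₀, hw, hG⟩ := stub_verticalPeriod Q hh
  obtain ⟨τu, τd, hτ⟩ := stub_adjacentHeights Q ⟨c₀, hc₀, hw, hG⟩
  exact stub_sumToMin Q c₀ τu τd hsep hh hc₀ hw hG hτ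
    (fun t t' B Ft Ft' rep rep' V htt ht ht' hFt hFt' hrep hrep' hB =>
      stub_restackEnergy Q c₀ t t' B Ft Ft' rep rep' V hh hc₀ hw hG htt ht ht' hFt hFt' hrep hrep' hB)
    (hD Q τu τd hsep hh hτ)

end Summit.AtomisticToContinuum.Crystallization.Theorems.ChessboardParticlePlanesLjPlaneChessboard

end
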